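import Mathlib
import HarnessLib
import Summits.HubbardSuperconductivity.HubbardSuperconductivity.Theorems.ChiralWindowCwKLChiralWindowNodeBound
import Summits.HubbardSuperconductivity.HubbardSuperconductivity.Theorems.ChiralWindowCwKLChiralWindowCertTrig

/-!
# Crux `CwKLChiralWindow` (stmt-1741), line `Sketch`: block-level node data (F4b)

`stub_klBlockNode`: the block-level form of the pointwise amplitude bounds of `…NodeBound` (`stub_klNodeBound`).
For `μ ∈ (-4,0)`, a certificate block `b : KLBlock` (vocabulary of `Theorems/ChiralWindowDefs.lean`) with Temple data
accepted by the checker (`b.templeOK tab χ = true`) in a channel `χ ≠ A1g` without the bare-`U` term (`b.withU = false`),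
the block enclosures `b.Enclosure tab μ χ`, a row bound `R2` for `χ₀` and the multiplicity condition
`Hhi < 2ρhi²` (`3ρhi²` on `E`), every bottom state `ψ` of the channel obeys a.e. on the Fermi curve
`|F_Φ(k)| ≤ √N (|L| |ψ(k)| + √R2 √e)` off `E` and `|F_Φ(k)|, |F_Φ(rot³k)| ≤ √N (|L| √(ψ(k)² + ψ(rot k)²) + √R2 √e)` on `E`,
where `Φ = b.trialFun tab`, `F_Φ = ∫ χ₀ Φ`, `N = ∫ Φ²`, `L = b.lower tab χ` (Temple) and `e = b.kato` (Kato).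

Proof: instantiate `stub_klNodeBound` with the block's data — `withU := b.withU (= false)`, the trial `Φ`, the casts of
`b.rholo, b.rhohi, b.alpha, b.Hhi, b.beta`, and the deflation family read off `b.defl` — discharging its real hypotheses
from the Boolean test (`templeOK`, unpacked by `simp`) and the enclosures (`kl_bkn_rayleigh`: the Rayleigh-quotient
bookkeeping `ρlo N ≤ Q ≤ ρhi N`, `ρhi < 0`, `T ≤ α N`), and translating `min (temple ρlo) (temple ρhi)` to `b.lower`
and `(α - ρhi²)/(β - ρhi)²` to `b.kato` by `push_cast`.
-/

noncomputable section

set_option linter.dupNamespace false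

namespace Summit.HubbardSuperconductivity.HubbardSuperconductivity.Theorems

open MeasureTheory Literature.MathematicalPhysics.QuantumLattice CwKLChiralWindow

/-- The deflation kernel of a block as a `Fin`-indexed sum over its deflation list. [folklore] -/
theorem kl_bkn_deflKernel_eq (b : KLBlock) (tab : List KLTrig) (k k' : Momentum) :
    b.deflKernel tab k k' = ∑ m : Fin b.defl.length,
      ((b.defl[m.1]).1 : ℝ) * ((klTab tab (b.defl[m.1]).2).toFun k * (klTab tab (b.defl[m.1]).2).toFun k') := by
  unfold KLBlock.deflKernel
  rw [← Fin.sum_univ_fun_getElem]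

/-- **Rayleigh-quotient bookkeeping.** From the enclosures `0 < Nlo ≤ N ≤ Nhi`, `Qlo ≤ Q ≤ Qhi < 0`, `T ≤ Thi`, `0 ≤ Thi`:
`0 < N`, `min (Qlo/Nlo) (Qlo/Nhi) · N ≤ Q ≤ max (Qhi/Nlo) (Qhi/Nhi) · N`, `max (Qhi/Nlo) (Qhi/Nhi) < 0` and
`T ≤ (Thi/Nlo) · N`. [folklore] -/
theorem kl_bkn_rayleigh {Nlo Nhi Qlo Qhi Thi N Q T : ℝ} (hNlo : 0 < Nlo) (hN1 : Nlo ≤ N) (hN2 : N ≤ Nhi)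
    (hQ1 : Qlo ≤ Q) (hQ2 : Q ≤ Qhi) (hQhi : Qhi < 0) (hT : T ≤ Thi) (hThi : 0 ≤ Thi) :
    0 < N ∧ min (Qlo / Nlo) (Qlo / Nhi) * N ≤ Q ∧ Q ≤ max (Qhi / Nlo) (Qhi / Nhi) * N ∧
      max (Qhi / Nlo) (Qhi / Nhi) < 0 ∧ T ≤ Thi / Nlo * N := by
  have hN : 0 < N := lt_of_lt_of_le hNlo hN1
  have hNhi : 0 < Nhi := lt_of_lt_of_le hN hN2
  refine ⟨hN, ?_, ?_, max_lt (div_neg_of_neg_of_pos hQhi hNlo) (div_neg_of_neg_of_pos hQhi hNhi), ?_⟩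
  · rcases le_or_gt 0 Qlo with hQlo | hQlo
    · calc min (Qlo / Nlo) (Qlo / Nhi) * N ≤ Qlo / Nhi * N :=
            mul_le_mul_of_nonneg_right (min_le_right _ _) hN.le
        _ ≤ Qlo / Nhi * Nhi := mul_le_mul_of_nonneg_left hN2 (div_nonneg hQlo hNhi.le)
        _ = Qlo := div_mul_cancel₀ Qlo hNhi.ne'
        _ ≤ Q := hQ1
    · calc min (Qlo / Nlo) (Qlo / Nhi) * N ≤ Qlo / Nlo * N :=
            mul_le_mul_of_nonneg_right (min_le_left _ _) hN.le
        _ ≤ Qlo / Nlo * Nlo := mul_le_mul_of_nonpos_left hN1 (div_neg_of_neg_of_pos hQlo hNlo).le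
        _ = Qlo := div_mul_cancel₀ Qlo hNlo.ne'
        _ ≤ Q := hQ1
  · calc Q ≤ Qhi := hQ2
      _ = Qhi / Nhi * Nhi := (div_mul_cancel₀ Qhi hNhi.ne').symm
      _ ≤ Qhi / Nhi * N := mul_le_mul_of_nonpos_left hN2 (div_neg_of_neg_of_pos hQhi hNhi).le
      _ ≤ max (Qhi / Nlo) (Qhi / Nhi) * N := mul_le_mul_of_nonneg_right (le_max_right _ _) hN.le
  · calc T ≤ Thi := hT
      _ = Thi / Nlo * Nlo := (div_mul_cancel₀ Thi hNlo.ne').symm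
      _ ≤ Thi / Nlo * N := mul_le_mul_of_nonneg_left hN1 (div_nonneg hThi hNlo.le)

/-- **Block-level node data (F4b).** For `μ ∈ (-4,0)`, a block `b` with Temple data in a channel `χ ≠ A1g` without the
bare-`U` term, the block enclosures, a row bound `R2` and the multiplicity condition `Hhi < 2ρhi²` (`3ρhi²` on `E`):
every bottom state `ψ` of the channel obeys, a.e. on the Fermi curve, `|F_Φ(k)| ≤ √N (|L| |ψ(k)| + √R2 √e)` off `E` and
`|F_Φ(k)|, |F_Φ(rot³k)| ≤ √N (|L| √(ψ(k)² + ψ(rot k)²) + √R2 √e)` on `E` (`Φ` the block's trial, `F_Φ = ∫ χ₀ Φ`,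
`N = ∫Φ²`, `L = b.lower`, `e = b.kato`). [folklore] -/
theorem stub_klBlockNode : ∀ μ ∈ Set.Ioo (-4 : ℝ) 0, ∀ (b : KLBlock) (tab : List KLTrig) (χ : D4Irrep) (R2 : ℝ),
    b.templeOK tab χ = true → b.withU = false → χ ≠ D4Irrep.A1g → b.Enclosure tab μ χ → 0 ≤ R2 →
    (∀ᵐ k ∂fermiCurveMeasure (squareDispersion 1 0) μ,
      ∫ k', lindhardFunction (squareDispersion 1 0) μ (k + k') ^ 2 ∂fermiCurveMeasure (squareDispersion 1 0) μ ≤ R2) →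
    (b.Hhi : ℝ) < (if χ = D4Irrep.E then 3 else 2) * (b.rhohi : ℝ) ^ 2 →
    ∀ ψ : Momentum → ℝ, IsChannelState (squareDispersion 1 0) μ χ ψ →
      pairingForm (squareDispersion 1 0) μ 1 ψ = channelInf (squareDispersion 1 0) μ 1 χ →
      (χ ≠ D4Irrep.E → ∀ᵐ k ∂fermiCurveMeasure (squareDispersion 1 0) μ,
        |∫ k', lindhardFunction (squareDispersion 1 0) μ (k + k') * b.trialFun tab k'
            ∂fermiCurveMeasure (squareDispersion 1 0) μ| ≤
          Real.sqrt (∫ k, b.trialFun tab k ^ 2 ∂fermiCurveMeasure (squareDispersion 1 0) μ) *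
            (|((b.lower tab χ : ℚ) : ℝ)| * |ψ k| + Real.sqrt R2 * Real.sqrt ((b.kato : ℚ) : ℝ))) ∧
      (χ = D4Irrep.E → ∀ᵐ k ∂fermiCurveMeasure (squareDispersion 1 0) μ,
        |∫ k', lindhardFunction (squareDispersion 1 0) μ (k + k') * b.trialFun tab k'
            ∂fermiCurveMeasure (squareDispersion 1 0) μ| ≤
          Real.sqrt (∫ k, b.trialFun tab k ^ 2 ∂fermiCurveMeasure (squareDispersion 1 0) μ) *
            (|((b.lower tab χ : ℚ) : ℝ)| * Real.sqrt (ψ k ^ 2 + ψ (rotMomentum k) ^ 2) +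
              Real.sqrt R2 * Real.sqrt ((b.kato : ℚ) : ℝ)) ∧
        |∫ k', lindhardFunction (squareDispersion 1 0) μ (rotMomentum (rotMomentum (rotMomentum k)) + k') *
            b.trialFun tab k' ∂fermiCurveMeasure (squareDispersion 1 0) μ| ≤
          Real.sqrt (∫ k, b.trialFun tab k ^ 2 ∂fermiCurveMeasure (squareDispersion 1 0) μ) *
            (|((b.lower tab χ : ℚ) : ℝ)| * Real.sqrt (ψ k ^ 2 + ψ (rotMomentum k) ^ 2) +
              Real.sqrt R2 * Real.sqrt ((b.kato : ℚ) : ℝ))) := by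
  intro μ hμ b tab χ R2 hT hWU hχA hE hR2 hR hmul ψ hψs hbot
  -- the Boolean test, unpacked
  have hT' := hT
  simp only [KLBlock.templeOK, KLBlock.ritzOK, KLBlock.deflOK, Bool.and_eq_true, decide_eq_true_eq,
    List.all_eq_true, Bool.or_eq_true, Bool.not_eq_true'] at hT'
  obtain ⟨⟨⟨⟨⟨⟨⟨⟨⟨⟨⟨⟨huse, -⟩, hfits⟩, hNlo⟩, -⟩, -⟩, hQhi⟩, -⟩, hdefl⟩, hThi⟩, hβ0⟩, hHβ⟩, hρβ⟩ := hT'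
  -- the enclosures, unpacked
  obtain ⟨h1, hH⟩ := hE
  obtain ⟨hN1, hN2, hQ1, hQ2, hTT⟩ := h1 huse
  unfold KLBlock.baseKernel at hQ1 hQ2 hTT
  simp only [KLBlock.sectorKernel, KLBlock.baseKernel, kl_bkn_deflKernel_eq] at hH
  -- the real hypotheses of `stub_klNodeBound`
  obtain ⟨hN, hρlo, hρhi, hρhi0, hα⟩ := kl_bkn_rayleigh (by exact_mod_cast hNlo) hN1 hN2 hQ1 hQ2
    (by exact_mod_cast hQhi) hTT (by exact_mod_cast hThi)
  have hρlo_eq : ((b.rholo : ℚ) : ℝ) = min ((b.Qlo : ℝ) / b.Nlo) ((b.Qlo : ℝ) / b.Nhi) := by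
    rw [KLBlock.rholo]; push_cast; rfl
  have hρhi_eq : ((b.rhohi : ℚ) : ℝ) = max ((b.Qhi : ℝ) / b.Nlo) ((b.Qhi : ℝ) / b.Nhi) := by
    rw [KLBlock.rhohi]; push_cast; rfl
  have hα_eq : ((b.alpha : ℚ) : ℝ) = (b.Thi : ℝ) / b.Nlo := by
    rw [KLBlock.alpha]; push_cast; rfl
  rw [← hρlo_eq] at hρlo
  rw [← hρhi_eq] at hρhi hρhi0
  rw [← hα_eq] at hα
  have hd : ((KLBlock.dmult χ : ℚ) : ℝ) = if χ = D4Irrep.E then 2 else 1 := by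
    unfold KLBlock.dmult; split_ifs <;> norm_num
  have hHβ' : (b.Hhi : ℝ) - (if χ = D4Irrep.E then 2 else 1) * (b.rhohi : ℝ) ^ 2 ≤ (b.beta : ℝ) ^ 2 := by
    rw [← hd]; exact_mod_cast hHβ
  have hR' : ∀ᵐ k ∂fermiCurveMeasure (squareDispersion 1 0) μ, ∫ k', ((if b.withU then 1 else 0) +
      lindhardFunction (squareDispersion 1 0) μ (k + k')) ^ 2 ∂fermiCurveMeasure (squareDispersion 1 0) μ ≤ R2 := by
    simpa only [hWU, Bool.false_eq_true, ↓reduceIte, zero_add] using hR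
  -- the translations of `lower` and `kato`
  have hlower : ((b.lower tab χ : ℚ) : ℝ) = min (((b.beta : ℝ) * b.rholo - b.alpha) / (b.beta - b.rholo))
      (((b.beta : ℝ) * b.rhohi - b.alpha) / (b.beta - b.rhohi)) := by
    rw [KLBlock.lower, if_pos hT]; simp only [KLBlock.temple]; push_cast; rfl
  have hkato : ((b.kato : ℚ) : ℝ) = ((b.alpha : ℝ) - b.rhohi ^ 2) / (b.beta - b.rhohi) ^ 2 := by
    rw [KLBlock.kato]; push_cast; rfl
  -- the abstract node bound, instantiated with the block's data
  have hnb := stub_klNodeBound μ hμ χ b.withU b.defl.length (fun m => ((b.defl[m.1]).1 : ℝ))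
    (fun m => (klTab tab (b.defl[m.1]).2).toFun) (b.trialFun tab) b.rholo b.rhohi b.alpha b.Hhi b.beta R2
    (fun h => absurd (hWU.symm.trans h) Bool.false_ne_true)
    (fun m => Rat.cast_nonneg.2 (hdefl _ (List.getElem_mem m.2)).1.1)
    (fun m => kl_tr_toFun_memLp _ hμ) (kl_tr_toFun_memLp _ hμ) (stub_klTrigChannel _ χ hfits) hN hρlo hρhi hρhi0
    hα hH (by exact_mod_cast hβ0) hHβ' (by exact_mod_cast hρβ) (Or.inr hχA) hR2 hR' hmul ψ hψs hbot
  rw [hlower, hkato]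
  simp only [hWU, Bool.false_eq_true, ↓reduceIte, zero_add] at hnb
  exact hnb

end Summit.HubbardSuperconductivity.HubbardSuperconductivity.Theorems

end
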